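import Literature.Analysis.Complex.PolynomialGrowthLiouville
import HarnessLib

/-!
# The characteristic polynomial of a function along a finite branched covering of the line

Layer `Literature/Analysis/Complex`. O. Forster, *Lectures on Riemann Surfaces*, GTM 81 (1981), §8
Thm. 8.3 (the elementary symmetric functions of a function along a proper finite holomorphic map are
holomorphic downstairs, and the function satisfies the resulting monic equation), in the affine,
polynomial-growth form used to algebraise finite coverings of affine curves: let `F : T → ℂ` be a
PROPER map with finite fibres from a Hausdorff space without isolated points, a local homeomorphism
at every point over the complement of a finite set `Δ ⊆ ℂ`, and `h : T → ℂ` a continuous function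
which is holomorphic along the local inverses of `F` over `ℂ ∖ Δ` and of polynomial growth
`|h| ≤ C (1 + |F|)^K`. Then there is a MONIC polynomial `R ∈ ℂ[z][τ]` with `R(F(t), h(t)) = 0` for
every `t ∈ T`:

* `exists_nhds_fibre_eq_image` — local simultaneous sections: over a neighbourhood `V` of a good
  value `z`, the fibres of `F` are the images of the fibre over `z` under the local inverses, injectively
  (properness: `F(T ∖ ⋃ sheets)` is closed);
* `norm_coeff_prod_X_sub_C_le`, `differentiableOn_coeff_prod_X_sub_C` — the coefficients of
  `∏ (τ - a_i)` are bounded by `∏ (1 + |a_i|)` and depend holomorphically on holomorphic `a_i`;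
* `exists_differentiable_extension` — Riemann's removable singularity theorem at finitely many
  points (Mathlib's `Complex.differentiableOn_update_limUnder_of_bddAbove`);
* `exists_charPoly` — **the theorem**: the coefficients `σ_k(z)` of `∏_{F(t) = z} (τ - h(t))` are
  holomorphic off `Δ` (local sections), bounded near `Δ` (properness), hence entire, of polynomial
  growth, hence POLYNOMIALS (`Literature.Analysis.Complex.exists_eq_sum_of_differentiable_of_growth`,
  Liouville); the fibre cardinality is constant off `Δ` (`ℂ ∖ Δ` is connected; Thm. 4.24), so
  `R = ∑ σ_k τ^k` is monic, and `R(F, h) = 0` off `F⁻¹(Δ)` hence everywhere by density and continuity.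

Everything is proved; there are no definitions.

## References

* O. Forster, *Lectures on Riemann Surfaces*, GTM 81, Springer (1981), §8.1, Thm. 8.2, Thm. 8.3;
  §4 Lemma 4.21, Thm. 4.22 (proper local homeomorphisms are coverings), Thm. 4.24 (constancy of the
  number of sheets). [Forster1981]
-/

noncomputable section

open scoped Topology Polynomial
open Set Filter Function Polynomial

namespace Literature.Analysis.Complex

namespace BranchedCovering

variable {T : Type*} [TopologicalSpace T]

/-! ### Local simultaneous sections of a proper local homeomorphism -/

/-- There are open partial homeomorphisms `T ⇀ ℂ` (the empty one) as soon as `T` has a point.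
[folklore] -/
theorem nonempty_openPartialHomeomorph (t₀ : T) : Nonempty (OpenPartialHomeomorph T ℂ) :=
  ⟨{ toFun := fun _ ↦ 0, invFun := fun _ ↦ t₀, source := ∅, target := ∅,
     map_source' := fun _ h ↦ h.elim, map_target' := fun _ h ↦ h.elim,
     left_inv' := fun _ h ↦ h.elim, right_inv' := fun _ h ↦ h.elim,
     open_source := isOpen_empty, open_target := isOpen_empty,
     continuousOn_toFun := continuousOn_empty _, continuousOn_invFun := continuousOn_empty _ }⟩

/-- **Local simultaneous sections** (Forster, Lemma 4.21 / Thm. 4.22 / §8.1): let `F : T → ℂ` be proper, `Φ`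
the (finite) fibre over `z`, and `e_t` (`t ∈ Φ`) local homeomorphisms agreeing with `F` and defined
at `t`. Then on an open neighbourhood `V` of `z` contained in all the targets, the fibre of `F` over
`z' ∈ V` is exactly `{e_t⁻¹(z') : t ∈ Φ}`, without repetitions.
[cite: Forster1981, §4 Lemma 4.21, Thm. 4.22; §8.1] -/
theorem exists_nhds_fibre_eq_image [T2Space T] {F : T → ℂ} (hprop : IsProperMap F) {z : ℂ} (Φ : Finset T)
    (hΦ : ∀ t, t ∈ Φ ↔ F t = z) (e : T → OpenPartialHomeomorph T ℂ) (he : ∀ t ∈ Φ, t ∈ (e t).source ∧ ⇑(e t) = F) :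
    ∃ V : Set ℂ, IsOpen V ∧ z ∈ V ∧ (∀ t ∈ Φ, V ⊆ (e t).target) ∧
      ∀ z' ∈ V, Set.InjOn (fun t ↦ (e t).symm z') ↑Φ ∧ F ⁻¹' {z'} = (fun t ↦ (e t).symm z') '' ↑Φ := by
  classical
  obtain ⟨W, hW, hdisj⟩ := Φ.finite_toSet.t2_separation
  -- the sheets and their union
  set S : Set T := ⋃ t ∈ Φ, ((e t).source ∩ W t) with hS
  have hSopen : IsOpen S := isOpen_biUnion fun t _ ↦ (e t).open_source.inter (hW t).2
  have hKclosed : IsClosed (F '' Sᶜ) := hprop.isClosedMap _ hSopen.isClosed_compl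
  have hzK : z ∉ F '' Sᶜ := by
    rintro ⟨t', ht'S, ht'z⟩
    apply ht'S
    have ht'Φ : t' ∈ Φ := (hΦ t').2 ht'z
    exact mem_biUnion (show t' ∈ (↑Φ : Set T) from ht'Φ) ⟨(he t' ht'Φ).1, (hW t').1⟩
  set V : Set ℂ := (F '' Sᶜ)ᶜ ∩ ⋂ t ∈ Φ, ((e t).target ∩ (e t).symm ⁻¹' W t) with hV
  refine ⟨V, ?_, ?_, ?_, ?_⟩
  · exact hKclosed.isOpen_compl.inter (isOpen_biInter_finset fun t _ ↦ (e t).isOpen_inter_preimage_symm (hW t).2)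
  · refine ⟨hzK, mem_iInter₂.2 fun t ht ↦ ?_⟩
    have hzt : z = (e t) t := by rw [(he t ht).2]; exact ((hΦ t).1 ht).symm
    refine ⟨?_, ?_⟩
    · rw [hzt]; exact (e t).map_source (he t ht).1
    · show (e t).symm z ∈ W t
      rw [hzt, (e t).left_inv (he t ht).1]
      exact (hW t).1
  · intro t ht z' hz'
    exact ((mem_iInter₂.1 hz'.2) t ht).1
  · intro z' hz'
    have hsec : ∀ t ∈ Φ, (e t).symm z' ∈ (e t).source ∩ W t := fun t ht ↦
      ⟨(e t).map_target ((mem_iInter₂.1 hz'.2) t ht).1, ((mem_iInter₂.1 hz'.2) t ht).2⟩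
    refine ⟨?_, ?_⟩
    · intro t₁ h₁ t₂ h₂ heq
      by_contra hne
      have hd : Disjoint (W t₁) (W t₂) := hdisj h₁ h₂ hne
      have h1 : (e t₁).symm z' ∈ W t₁ := (hsec t₁ h₁).2
      have h2 : (e t₁).symm z' ∈ W t₂ := by
        have : (fun t ↦ (e t).symm z') t₁ = (fun t ↦ (e t).symm z') t₂ := heq
        simp only at this
        rw [this]
        exact (hsec t₂ h₂).2
      exact Set.disjoint_left.1 hd h1 h2
    · ext t'
      refine ⟨fun ht' ↦ ?_, ?_⟩
      · have ht'z : F t' = z' := ht'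
        have ht'S : t' ∈ S := by
          by_contra h
          exact hz'.1 ⟨t', h, ht'z⟩
        rw [hS, mem_iUnion₂] at ht'S
        obtain ⟨t, ht, hts, -⟩ := ht'S
        refine ⟨t, ht, ?_⟩
        show (e t).symm z' = t'
        rw [← ht'z, ← (he t ht).2, (e t).left_inv hts]
      · rintro ⟨t, ht, rfl⟩
        show F ((e t).symm z') = z'
        rw [← (he t ht).2, (e t).right_inv ((mem_iInter₂.1 hz'.2) t ht).1]

/-! ### Coefficients of `∏ (τ - aᵢ)` -/

/-- The coefficients of `∏ᵢ (X - aᵢ)` are bounded by `∏ᵢ (1 + |aᵢ|)`. [folklore] -/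
theorem norm_coeff_prod_X_sub_C_le {ι : Type*} (s : Finset ι) (a : ι → ℂ) (k : ℕ) :
    ‖(∏ i ∈ s, (X - C (a i))).coeff k‖ ≤ ∏ i ∈ s, (1 + ‖a i‖) := by
  classical
  induction s using Finset.induction_on generalizing k with
  | empty =>
    simp only [Finset.prod_empty, coeff_one]
    split_ifs <;> simp
  | insert i s hi ih =>
    rw [Finset.prod_insert hi, Finset.prod_insert hi, sub_mul, coeff_sub, coeff_C_mul]
    have hnn : 0 ≤ ∏ j ∈ s, (1 + ‖a j‖) := Finset.prod_nonneg fun _ _ ↦ by positivity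
    cases k with
    | zero =>
      rw [coeff_X_mul_zero, zero_sub, norm_neg, norm_mul]
      calc ‖a i‖ * ‖(∏ j ∈ s, (X - C (a j))).coeff 0‖ ≤ ‖a i‖ * ∏ j ∈ s, (1 + ‖a j‖) := by gcongr; exact ih 0
        _ ≤ (1 + ‖a i‖) * ∏ j ∈ s, (1 + ‖a j‖) := by gcongr; linarith
    | succ k =>
      rw [coeff_X_mul]
      calc ‖(∏ j ∈ s, (X - C (a j))).coeff k - a i * (∏ j ∈ s, (X - C (a j))).coeff (k + 1)‖
          ≤ ‖(∏ j ∈ s, (X - C (a j))).coeff k‖ + ‖a i‖ * ‖(∏ j ∈ s, (X - C (a j))).coeff (k + 1)‖ :=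
            (norm_sub_le _ _).trans (by rw [norm_mul])
        _ ≤ (∏ j ∈ s, (1 + ‖a j‖)) + ‖a i‖ * ∏ j ∈ s, (1 + ‖a j‖) := by gcongr <;> apply ih
        _ = (1 + ‖a i‖) * ∏ j ∈ s, (1 + ‖a j‖) := by ring

/-- The coefficients of `∏ᵢ (X - aᵢ(z))` depend holomorphically on holomorphic `aᵢ`. [folklore] -/
theorem differentiableOn_coeff_prod_X_sub_C {ι : Type*} (s : Finset ι) {a : ι → ℂ → ℂ} {V : Set ℂ}
    (ha : ∀ i ∈ s, DifferentiableOn ℂ (a i) V) (k : ℕ) :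
    DifferentiableOn ℂ (fun z ↦ (∏ i ∈ s, (X - C (a i z))).coeff k) V := by
  classical
  induction s using Finset.induction_on generalizing k with
  | empty =>
    simp only [Finset.prod_empty, coeff_one]
    exact differentiableOn_const _
  | insert i s hi ih =>
    have ha' : ∀ j ∈ s, DifferentiableOn ℂ (a j) V := fun j hj ↦ ha j (Finset.mem_insert_of_mem hj)
    have hai : DifferentiableOn ℂ (a i) V := ha i (Finset.mem_insert_self i s)
    cases k with
    | zero =>
      have heq : ∀ z, (∏ j ∈ insert i s, (X - C (a j z))).coeff 0 = -(a i z * (∏ j ∈ s, (X - C (a j z))).coeff 0) := by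
        intro z
        rw [Finset.prod_insert hi, sub_mul, coeff_sub, coeff_C_mul, coeff_X_mul_zero, zero_sub]
      simp_rw [heq]
      exact (hai.mul (ih ha' 0)).neg
    | succ k =>
      have heq : ∀ z, (∏ j ∈ insert i s, (X - C (a j z))).coeff (k + 1) =
          (∏ j ∈ s, (X - C (a j z))).coeff k - a i z * (∏ j ∈ s, (X - C (a j z))).coeff (k + 1) := by
        intro z
        rw [Finset.prod_insert hi, sub_mul, coeff_sub, coeff_C_mul, coeff_X_mul]
      simp_rw [heq]
      exact (ih ha' k).sub (hai.mul (ih ha' (k + 1)))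

/-! ### Removable singularities at finitely many points -/

/-- **Riemann's removable singularity theorem at finitely many points**: a function holomorphic off a
finite set `Δ` and bounded near each point of `Δ` agrees off `Δ` with an entire function.
[cite: Forster1981, §1 (Riemann's theorem)] -/
theorem exists_differentiable_extension {Δ : Set ℂ} (hΔ : Δ.Finite) {σ : ℂ → ℂ} (hd : DifferentiableOn ℂ σ Δᶜ)
    (hb : ∀ c ∈ Δ, ∃ B : ℝ, ∀ᶠ z in 𝓝[≠] c, ‖σ z‖ ≤ B) :
    ∃ G : ℂ → ℂ, Differentiable ℂ G ∧ EqOn G σ Δᶜ := by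
  classical
  refine ⟨fun z ↦ if z ∈ Δ then limUnder (𝓝[≠] z) σ else σ z, fun z ↦ ?_, fun z hz ↦ if_neg hz⟩
  have hclosed : IsClosed Δ := hΔ.isClosed
  by_cases hz : z ∈ Δ
  · obtain ⟨B, hB⟩ := hb z hz
    -- a ball around `z` avoiding the rest of `Δ`, on which `σ` is bounded
    have hU : (Δ \ {z})ᶜ ∈ 𝓝 z := (hΔ.subset Set.sdiff_subset).isClosed.isOpen_compl.mem_nhds fun h ↦ h.2 rfl
    have h1 : ∀ᶠ w in 𝓝 z, w ∈ ({z}ᶜ : Set ℂ) → ‖σ w‖ ≤ B := eventually_nhdsWithin_iff.1 hB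
    obtain ⟨r, hr, hball⟩ := Metric.eventually_nhds_iff_ball.1 (h1.and hU)
    have hsub : Metric.ball z r \ {z} ⊆ Δᶜ := by
      rintro w ⟨hw, hwz⟩ hwΔ
      exact (hball w hw).2 ⟨hwΔ, hwz⟩
    have hdiff : DifferentiableOn ℂ (update σ z (limUnder (𝓝[≠] z) σ)) (Metric.ball z r) := by
      refine Complex.differentiableOn_update_limUnder_of_bddAbove (Metric.ball_mem_nhds z hr) (hd.mono hsub) ⟨B, ?_⟩
      rintro _ ⟨w, hw, rfl⟩
      exact (hball w hw.1).1 hw.2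
    have hat : DifferentiableAt ℂ (update σ z (limUnder (𝓝[≠] z) σ)) z :=
      hdiff.differentiableAt (Metric.ball_mem_nhds z hr)
    refine hat.congr_of_eventuallyEq ?_
    filter_upwards [Metric.ball_mem_nhds z hr] with w hw
    by_cases hwz : w = z
    · subst hwz
      simp only [if_pos hz, update_self]
    · have hwΔ : w ∉ Δ := hsub ⟨hw, hwz⟩
      simp only [if_neg hwΔ, update_of_ne hwz]
  · have hopen : Δᶜ ∈ 𝓝 z := hclosed.isOpen_compl.mem_nhds hz
    have hσ : DifferentiableAt ℂ σ z := hd.differentiableAt hopen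
    refine hσ.congr_of_eventuallyEq ?_
    filter_upwards [hopen] with w hw
    exact if_neg hw

/-! ### The characteristic polynomial -/

/-- The complement of a finite subset of `ℂ` is preconnected. [folklore] -/
theorem isPreconnected_compl_of_finite {Δ : Set ℂ} (hΔ : Δ.Finite) : IsPreconnected Δᶜ :=
  (hΔ.countable.isPathConnected_compl_of_one_lt_rank
    (by rw [Complex.rank_real_complex]; exact Nat.one_lt_ofNat)).isConnected.isPreconnected

/-- The complement of a finite subset of `ℂ` is dense. [folklore] -/
theorem dense_compl_of_finite {Δ : Set ℂ} (hΔ : Δ.Finite) : Dense Δᶜ :=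
  hΔ.countable.dense_compl ℂ

/-- **The characteristic polynomial of a function along a finite branched covering of `ℂ`**
(Forster, Thm. 8.3, affine polynomial-growth form). Let `F : T → ℂ` be proper with finite fibres on
a Hausdorff space without isolated points, a local homeomorphism at every point over `ℂ ∖ Δ` (`Δ`
finite) through local inverses along which the continuous function `h` is holomorphic, and let
`|h| ≤ C₀ (1 + |F|)^K`. Then there is a monic `R ∈ ℂ[z][τ]` with `R(F(t))(h(t)) = 0` for all `t`.
[cite: Forster1981, §8 Thm. 8.3] -/
theorem exists_charPoly [T2Space T] [∀ t : T, (𝓝[≠] t).NeBot] {F : T → ℂ} (hprop : IsProperMap F)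
    (hfin : ∀ z, (F ⁻¹' {z}).Finite) {Δ : Set ℂ} (hΔ : Δ.Finite) {h : T → ℂ} (hh : Continuous h)
    (hloc : ∀ t, F t ∉ Δ → ∃ e : OpenPartialHomeomorph T ℂ,
      t ∈ e.source ∧ ⇑e = F ∧ DifferentiableOn ℂ (h ∘ e.symm) e.target)
    {C₀ : ℝ} {K : ℕ} (hgrowth : ∀ t, ‖h t‖ ≤ C₀ * (1 + ‖F t‖) ^ K) :
    ∃ R : Polynomial (Polynomial ℂ), R.Monic ∧
      ∀ t, (R.map (Polynomial.evalRingHom (F t))).eval (h t) = 0 := by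
  classical
  -- the empty case
  rcases isEmpty_or_nonempty T with hT | ⟨⟨t₀⟩⟩
  · exact ⟨X, monic_X, fun t ↦ (IsEmpty.false t).elim⟩
  have hF : Continuous F := hprop.continuous
  -- a choice of local inverses
  set e : T → OpenPartialHomeomorph T ℂ := fun t ↦
    if ht : F t ∉ Δ then (hloc t ht).choose else Classical.choice (nonempty_openPartialHomeomorph t₀) with he_def
  have he : ∀ t, F t ∉ Δ → t ∈ (e t).source ∧ ⇑(e t) = F ∧ DifferentiableOn ℂ (h ∘ (e t).symm) (e t).target := by
    intro t ht
    have : e t = (hloc t ht).choose := by simp only [he_def, dif_pos ht]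
    rw [this]
    exact (hloc t ht).choose_spec
  -- fibres, the fibrewise polynomial and its coefficients
  set fib : ℂ → Finset T := fun z ↦ (hfin z).toFinset with hfib_def
  have hfib : ∀ z t, t ∈ fib z ↔ F t = z := fun z t ↦ by
    simp only [hfib_def, Finite.mem_toFinset, mem_preimage, mem_singleton_iff]
  set p : ℂ → ℂ[X] := fun z ↦ ∏ t ∈ fib z, (X - C (h t)) with hp_def
  set σ : ℕ → ℂ → ℂ := fun k z ↦ (p z).coeff k with hσ_def
  have hp_monic : ∀ z, (p z).Monic := fun z ↦ monic_prod_X_sub_C _ _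
  have hp_deg : ∀ z, (p z).natDegree = (fib z).card := fun z ↦ natDegree_finsetProd_X_sub_C_eq_card _ _
  -- local structure over a good value
  have hlocal : ∀ z, z ∉ Δ → ∃ V : Set ℂ, IsOpen V ∧ z ∈ V ∧ (∀ t ∈ fib z, DifferentiableOn ℂ (fun z' ↦ h ((e t).symm z')) V) ∧
      ∀ z' ∈ V, p z' = ∏ t ∈ fib z, (X - C (h ((e t).symm z'))) ∧ (fib z').card = (fib z).card := by
    intro z hz
    have he' : ∀ t ∈ fib z, t ∈ (e t).source ∧ ⇑(e t) = F := fun t ht ↦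
      ⟨(he t (by rwa [(hfib z t).1 ht])).1, (he t (by rwa [(hfib z t).1 ht])).2.1⟩
    obtain ⟨V, hVopen, hzV, hVsub, hV⟩ := exists_nhds_fibre_eq_image hprop (fib z) (hfib z) e he'
    refine ⟨V, hVopen, hzV, fun t ht ↦ ?_, fun z' hz' ↦ ?_⟩
    · exact ((he t (by rwa [(hfib z t).1 ht])).2.2).mono (hVsub t ht)
    · obtain ⟨hinj, hpre⟩ := hV z' hz'
      have hfib' : fib z' = (fib z).image fun t ↦ (e t).symm z' := by
        ext t'
        rw [hfib, Finset.mem_image]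
        have : t' ∈ F ⁻¹' {z'} ↔ t' ∈ (fun t ↦ (e t).symm z') '' ↑(fib z) := by rw [hpre]
        simpa only [mem_preimage, mem_singleton_iff, mem_image, Finset.mem_coe] using this
      refine ⟨?_, ?_⟩
      · simp only [hp_def, hfib']
        rw [Finset.prod_image hinj]
      · rw [hfib', Finset.card_image_of_injOn hinj]
  -- holomorphy of the coefficients off `Δ`
  have hσdiff : ∀ k, DifferentiableOn ℂ (σ k) Δᶜ := by
    intro k z hz
    obtain ⟨V, hVopen, hzV, hdiffV, hV⟩ := hlocal z hz
    have h1 : DifferentiableOn ℂ (fun z' ↦ (∏ t ∈ fib z, (X - C (h ((e t).symm z')))).coeff k) V :=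
      differentiableOn_coeff_prod_X_sub_C (fib z) (a := fun t z' ↦ h ((e t).symm z')) hdiffV k
    have h2 : DifferentiableAt ℂ (σ k) z := by
      refine ((h1 z hzV).differentiableAt (hVopen.mem_nhds hzV)).congr_of_eventuallyEq ?_
      filter_upwards [hVopen.mem_nhds hzV] with z' hz'
      simp only [hσ_def, (hV z' hz').1]
    exact h2.differentiableWithinAt
  -- constancy of the fibre cardinality off `Δ`
  obtain ⟨z₀, hz₀⟩ := hΔ.infinite_compl.nonempty
  set n : ℕ := (fib z₀).card with hn_def
  have hcard : ∀ z, z ∉ Δ → (fib z).card = n := by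
    intro z hz
    refine (isPreconnected_compl_of_finite hΔ).constant (f := fun z ↦ (fib z).card) ?_ hz hz₀
    intro w hw
    obtain ⟨V, hVopen, hwV, -, hV⟩ := hlocal w hw
    have hc : ContinuousAt (fun z ↦ (fib z).card) w := by
      refine (continuousAt_const (y := (fib w).card)).congr_of_eventuallyEq ?_
      filter_upwards [hVopen.mem_nhds hwV] with z' hz'
      exact (hV z' hz').2
    exact hc.continuousWithinAt
  -- the coefficient bound
  have hσbound : ∀ k z, ‖σ k z‖ ≤ ∏ t ∈ fib z, (1 + ‖h t‖) := fun k z ↦ norm_coeff_prod_X_sub_C_le _ _ _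
  have hprod_le : ∀ (z : ℂ) (B : ℝ), 0 ≤ B → (∀ t ∈ fib z, ‖h t‖ ≤ B) → ∏ t ∈ fib z, (1 + ‖h t‖) ≤ (1 + B) ^ (fib z).card := by
    intro z B hB hle
    calc ∏ t ∈ fib z, (1 + ‖h t‖) ≤ ∏ _t ∈ fib z, (1 + B) :=
          Finset.prod_le_prod (fun _ _ ↦ by positivity) fun t ht ↦ by linarith [hle t ht]
      _ = (1 + B) ^ (fib z).card := Finset.prod_const _
  -- boundedness near the points of `Δ`
  have hσnear : ∀ k, ∀ c ∈ Δ, ∃ B : ℝ, ∀ᶠ z in 𝓝[≠] c, ‖σ k z‖ ≤ B := by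
    intro k c hc
    have hcpt : IsCompact (F ⁻¹' Metric.closedBall c 1) := hprop.isCompact_preimage (isCompact_closedBall c 1)
    obtain ⟨B₀, hB₀⟩ := hcpt.exists_bound_of_continuousOn hh.continuousOn
    set B := max B₀ 0 with hB
    refine ⟨(1 + B) ^ n, ?_⟩
    have hU : (Δ \ {c})ᶜ ∈ 𝓝 c := (hΔ.subset Set.sdiff_subset).isClosed.isOpen_compl.mem_nhds fun h ↦ h.2 rfl
    have h1 : ∀ᶠ z in 𝓝[≠] c, z ∉ Δ := by
      filter_upwards [mem_nhdsWithin_of_mem_nhds hU, self_mem_nhdsWithin] with z hz hzc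
      exact fun hzΔ ↦ hz ⟨hzΔ, hzc⟩
    have h2 : ∀ᶠ z in 𝓝[≠] c, z ∈ Metric.ball c 1 := mem_nhdsWithin_of_mem_nhds (Metric.ball_mem_nhds c one_pos)
    filter_upwards [h1, h2] with z hz hzball
    calc ‖σ k z‖ ≤ ∏ t ∈ fib z, (1 + ‖h t‖) := hσbound k z
      _ ≤ (1 + B) ^ (fib z).card := hprod_le z B (le_max_right _ _) fun t ht ↦ by
          refine (hB₀ t ?_).trans (le_max_left _ _)
          rw [mem_preimage, (hfib z t).1 ht]
          exact Metric.ball_subset_closedBall hzball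
      _ = (1 + B) ^ n := by rw [hcard z hz]
  -- the global polynomial bound off `Δ`
  set C' : ℝ := max C₀ 0 with hC'
  have hσglobal : ∀ k z, z ∉ Δ → ‖σ k z‖ ≤ (1 + C') ^ n * (1 + ‖z‖) ^ (K * n) := by
    intro k z hz
    have hle : ∀ t ∈ fib z, ‖h t‖ ≤ C' * (1 + ‖z‖) ^ K := fun t ht ↦ by
      rw [← (hfib z t).1 ht]
      exact (hgrowth t).trans (by gcongr; exact le_max_left _ _)
    calc ‖σ k z‖ ≤ ∏ t ∈ fib z, (1 + ‖h t‖) := hσbound k z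
      _ ≤ (1 + C' * (1 + ‖z‖) ^ K) ^ (fib z).card := hprod_le z _ (by positivity) hle
      _ ≤ ((1 + C') * (1 + ‖z‖) ^ K) ^ (fib z).card := by
          gcongr
          have h1 : (1 : ℝ) ≤ (1 + ‖z‖) ^ K := one_le_pow₀ (by linarith [norm_nonneg z])
          nlinarith [le_max_right C₀ 0]
      _ = (1 + C') ^ n * (1 + ‖z‖) ^ (K * n) := by rw [hcard z hz, mul_pow, ← pow_mul]
  -- the entire extensions of the coefficients and their growth
  have hG : ∀ k, ∃ G : ℂ → ℂ, Differentiable ℂ G ∧ EqOn G (σ k) Δᶜ ∧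
      ∀ q : ℂ, 1 ≤ ‖q‖ → ‖G q‖ ≤ ((1 + C') ^ n * 2 ^ (K * n)) * ‖q‖ ^ ((K * n : ℕ) : ℝ) := by
    intro k
    obtain ⟨G, hGd, hGeq⟩ := exists_differentiable_extension hΔ (hσdiff k) (hσnear k)
    refine ⟨G, hGd, hGeq, ?_⟩
    -- the bound extends over `Δ` by continuity and density
    have hall : ∀ q, ‖G q‖ ≤ (1 + C') ^ n * (1 + ‖q‖) ^ (K * n) := by
      have hclosed : IsClosed {q : ℂ | ‖G q‖ ≤ (1 + C') ^ n * (1 + ‖q‖) ^ (K * n)} :=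
        isClosed_le hGd.continuous.norm (by fun_prop)
      have hsub : Δᶜ ⊆ {q : ℂ | ‖G q‖ ≤ (1 + C') ^ n * (1 + ‖q‖) ^ (K * n)} := fun q hq ↦ by
        show ‖G q‖ ≤ _
        rw [hGeq hq]
        exact hσglobal k q hq
      intro q
      exact hclosed.closure_subset_iff.2 hsub ((dense_compl_of_finite hΔ) q)
    intro q hq
    rw [Real.rpow_natCast]
    calc ‖G q‖ ≤ (1 + C') ^ n * (1 + ‖q‖) ^ (K * n) := hall q
      _ ≤ (1 + C') ^ n * (2 * ‖q‖) ^ (K * n) := by gcongr; linarith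
      _ = (1 + C') ^ n * 2 ^ (K * n) * ‖q‖ ^ (K * n) := by rw [mul_pow, mul_assoc]
  -- the coefficients are polynomials
  have hpoly : ∀ k, ∃ g : ℂ[X], ∀ z, z ∉ Δ → g.eval z = σ k z := by
    intro k
    obtain ⟨G, hGd, hGeq, hGb⟩ := hG k
    obtain ⟨c, hc⟩ := exists_eq_sum_of_differentiable_of_growth (K * n + 1) G ((K * n : ℕ) : ℝ) _
      (by exact_mod_cast Nat.lt_succ_self _) hGd hGb
    refine ⟨∑ j ∈ Finset.range (K * n + 1), C (c j) * X ^ j, fun z hz ↦ ?_⟩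
    rw [← hGeq hz, hc z, eval_finsetSum]
    simp only [eval_mul, eval_C, eval_pow, eval_X]
  choose g hg using hpoly
  -- the characteristic polynomial
  set R : Polynomial ℂ[X] := ∑ k ∈ Finset.range (n + 1), C (g k) * X ^ k with hR
  have hRcoeff : ∀ k, R.coeff k = if k ∈ Finset.range (n + 1) then g k else 0 := by
    intro k
    simp only [hR, finsetSum_coeff, coeff_C_mul_X_pow]
    rw [Finset.sum_ite_eq]
  -- specialisation at a good value is the fibrewise polynomial
  have hRmap : ∀ z, z ∉ Δ → R.map (evalRingHom z) = p z := by
    intro z hz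
    ext k
    rw [coeff_map, hRcoeff, coe_evalRingHom]
    split_ifs with hk
    · rw [hg k z hz]
    · rw [Finset.mem_range, not_lt] at hk
      rw [eval_zero]
      symm
      apply coeff_eq_zero_of_natDegree_lt
      rw [hp_deg, hcard z hz]
      omega
  -- `R` is monic of degree `n`
  have hgn : g n = 1 := by
    apply eq_of_infinite_eval_eq
    refine hΔ.infinite_compl.mono fun z hz ↦ ?_
    show (g n).eval z = (1 : ℂ[X]).eval z
    rw [eval_one, hg n z hz]
    show (p z).coeff n = 1
    have h := (hp_monic z).coeff_natDegree
    rwa [hp_deg, hcard z hz] at h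
  have hRmonic : R.Monic := by
    refine monic_of_natDegree_le_of_coeff_eq_one n ?_ ?_
    · refine natDegree_sum_le_of_forall_le _ _ fun k hk ↦ ?_
      refine (natDegree_C_mul_X_pow_le _ _).trans ?_
      rw [Finset.mem_range] at hk
      omega
    · rw [hRcoeff, if_pos (Finset.self_mem_range_succ n), hgn]
  refine ⟨R, hRmonic, ?_⟩
  -- the root property off `F⁻¹(Δ)` ...
  have hroot : ∀ t, F t ∉ Δ → (R.map (evalRingHom (F t))).eval (h t) = 0 := by
    intro t ht
    rw [hRmap (F t) ht, hp_def]
    simp only [eval_prod, eval_sub, eval_X, eval_C]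
    exact Finset.prod_eq_zero ((hfib (F t) t).2 rfl) (sub_self _)
  -- ... and everywhere, by density and continuity
  have hcont : Continuous fun t ↦ (R.map (evalRingHom (F t))).eval (h t) := by
    have heq : ∀ t, (R.map (evalRingHom (F t))).eval (h t) =
        ∑ k ∈ Finset.range (n + 1), (g k).eval (F t) * h t ^ k := by
      intro t
      simp only [hR, Polynomial.map_sum, Polynomial.map_mul, map_C, Polynomial.map_pow, map_X, coe_evalRingHom,
        eval_finsetSum, eval_mul, eval_C, eval_pow, eval_X]
    simp_rw [heq]
    exact continuous_finsetSum _ fun k _ ↦ ((g k).continuous.comp hF).mul (hh.pow k)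
  have hdense : Dense (F ⁻¹' Δ)ᶜ := by
    have hfinpre : (F ⁻¹' Δ).Finite := hΔ.preimage' fun b _ ↦ hfin b
    rw [compl_eq_univ_sdiff]
    exact dense_univ.sdiff_finite hfinpre
  have hzero : (fun t ↦ (R.map (evalRingHom (F t))).eval (h t)) = fun _ ↦ 0 :=
    Continuous.ext_on hdense hcont continuous_const fun t ht ↦ hroot t ht
  exact fun t ↦ congr_fun hzero t

end BranchedCovering

end Literature.Analysis.Complex
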